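import Literature.NumberTheory.EllipticCurves.ZpExtensionEisensteinOrdinaryInvariantsBoundProofs
import HarnessLib

/-!
# The scalar dichotomy `λ·(1+T)^{p^s} − c = unit` or `= [T]^{p^s} · unit` in `A_{m,k} = Λ/(T^m + p, p^k)`
# (theorems only — no definition, no named fact, no instance, no `sorry`)

Topic `NumberTheory/EllipticCurves` (sequel of x9-p1-w3's `ZpExtensionEisensteinTwistFixedPointTorsionProofs`:
`(1+T)^{p^s} − 1 = [T]^{p^s}(1 + [T]c)` for `m > p^s`, `isUnit_add_mk_X_mul`).  Brick (F4c-3)(i) of the uniform-`ι` road of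
cell `pub/bsd-print-x9` (stub `stub_h5bAtS`; x9-p1-w3 g6's design 2026-08-28T21:21:11Z: «the `g₀`-dichotomy `c·u^{∓p^s} − 1` is a
unit or `= unit·[T]^{p^s}` in `A_{m,k}` (`m > p^s`)»).

B. Howard, Compositio Math. 140 (2004), proof of Thm. 2.2.10 («`S_𝔮` is a discrete valuation ring», uniformiser `π = T`,
`π^m = −p`) and §3.1: at a place `w ∣ p` an element `g₀ ∈ Γ_{K_w}` with `κ(g₀) = p^s` acts on the LINES `Fil_w`, `gr_w` of the
Eisenstein level `E[p^k] ⊗ A_{m,k}(ψ)` by scalars `λ·u`, `u = (1+T)^{p^s}` (`λ ∈ ℤ` the scalar of `g₀` on the cyclic group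
`Fil_w E[p^k]`, resp. `gr_w E[p^k]`), and on `μ_{p^k}` by an integer `c` prime to `p`.  For the local-duality count of `H²`
(tree `natCard_two_le_natCard_quotient_span_of_cyclic_scalar`) one needs `[T]^{p^s} ∈ (λu − c)`:

* `isUnit_intCast_of_not_dvd` — an integer prime to `p` is a unit of `A_{m,k}`;
* `exists_intCast_mul_onePlusT_pow_sub_intCast_mul_eq_mk_X_pow` — **for `λ, c ∈ ℤ` with `p ∤ c` and `p^s < m` there is
  `ν ∈ A_{m,k}` with `(λ·(1+T)^{p^s} − c)·ν = [T]^{p^s}`**: if `p ∤ λ − c` then `λu − c = (λ − c) + [T]·(…)` is a unit; if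
  `p ∣ λ − c` then `λ − c ∈ pA = −[T]^m A` and `λu − c = [T]^{p^s}·(λ(1 + [T]c') − [T]^{m−p^s} r)` with a unit cofactor
  (`λ ≡ c` is prime to `p`).

Pure algebra in `A_{m,k}`; no curve, no Galois group.  No summit statement is proved; BSD is not proved by any of this.

References: [Howard2004HeegnerKolyvagin] §2.2 and proof of Thm. 2.2.10, §3.1; [Washington1997] §7.1 (units of local rings),
§13.2 (Lemma 13.7: `(1+T)^{p^n} − 1`); [GreenbergLNM1716] proof of Prop. 4.15 (the same unit/non-unit dichotomy for twisted
local invariants).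
-/

set_option autoImplicit false

noncomputable section

open Polynomial

namespace Literature.NumberTheory.EllipticCurves.IwasawaAlgebra.EisensteinCoeff

variable (p : ℕ) [hp : Fact p.Prime]

/-- **An integer prime to `p` is a unit of `A_{m,k}`** (it is a unit of `ℤ_p` — norm `1`, the tree's
`isUnit_intCast_padicInt_of_not_dvd` of `HeegnerEnvelopeReverseCoherentProofs`, re-proved in one line to keep this algebra file
light — pushed through `ℤ_p → A_{m,k}`). [cite: Washington1997, §7.1] -/
theorem isUnit_intCast_of_not_dvd (m k : ℕ) {c : ℤ} (hc : ¬ (p : ℤ) ∣ c) : IsUnit ((c : ℤ) : EisensteinCoeff p m k) := by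
  have hZp : IsUnit ((c : ℤ) : ℤ_[p]) := by
    rw [PadicInt.isUnit_iff]
    exact le_antisymm (PadicInt.norm_le_one _) (not_lt.mp fun h ↦ hc ((PadicInt.norm_int_lt_one_iff_dvd c).mp h))
  have h := hZp.map (algebraMap ℤ_[p] (EisensteinCoeff p m k))
  rwa [map_intCast] at h

/-- **The scalar dichotomy.**  For integers `λ`, `c` with `p ∤ c` and `p^s < m`, in `A_{m,k} = Λ/(T^m + p, p^k)` there is `ν`
with **`(λ·(1+T)^{p^s} − c)·ν = [T]^{p^s}`** — `λ(1+T)^{p^s} − c` is a unit when `p ∤ λ − c`, and `[T]^{p^s}` times a unit when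
`p ∣ λ − c` (`(1+T)^{p^s} − 1 = [T]^{p^s}(1 + [T]c')`, `p = −[T]^m`, `m > p^s`).  This is the input
`(μ − c)·ν = π^{p^s}` of `natCard_two_le_natCard_quotient_span_of_cyclic_scalar` for the lines `Fil_w`, `gr_w` of Howard's
Eisenstein levels at `w ∣ p` (`g₀` with `κ(g₀) = p^s` acting by `λ·(1+T)^{p^s}`, on `μ_{p^k}` by `c`).
[cite: Howard2004HeegnerKolyvagin, proof of Thm. 2.2.10 and §3.1] [cite: Washington1997, §13.2 (Lemma 13.7)]
[cite: GreenbergLNM1716, proof of Prop. 4.15] -/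
theorem exists_intCast_mul_onePlusT_pow_sub_intCast_mul_eq_mk_X_pow {m : ℕ} (k s : ℕ) (hms : p ^ s < m) (lam c : ℤ)
    (hc : ¬ (p : ℤ) ∣ c) :
    ∃ ν : EisensteinCoeff p m k,
      ((lam : EisensteinCoeff p m k) * onePlusT p m k ^ (p ^ s) - (c : EisensteinCoeff p m k)) * ν =
        (Ideal.Quotient.mk _ PowerSeries.X) ^ (p ^ s) := by
  obtain ⟨c', hc'⟩ := onePlusT_pow_prime_pow_sub_one_eq p k s hms
  obtain ⟨d, rfl⟩ := Nat.exists_eq_add_of_lt hms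
  set T : EisensteinCoeff p (p ^ s + d + 1) k := Ideal.Quotient.mk _ PowerSeries.X with hT
  -- `λu − c = λ(u − 1) + (λ − c) = λ T^{p^s} (1 + T c') + (λ − c)`
  have hx : (lam : EisensteinCoeff p (p ^ s + d + 1) k) * onePlusT p (p ^ s + d + 1) k ^ (p ^ s) -
        (c : EisensteinCoeff p (p ^ s + d + 1) k) =
      (lam : EisensteinCoeff p (p ^ s + d + 1) k) * (T ^ (p ^ s) * (1 + T * c')) +
        ((lam - c : ℤ) : EisensteinCoeff p (p ^ s + d + 1) k) := by
    rw [← hc', Int.cast_sub]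
    ring
  have hps : 1 ≤ p ^ s := Nat.one_le_pow _ _ hp.out.pos
  by_cases hdvd : (p : ℤ) ∣ (lam - c)
  · -- `p ∣ λ − c`: `λ − c = p r = −T^m r`, and `λ` is prime to `p`
    have hlam : ¬ (p : ℤ) ∣ lam := by
      intro h
      have h' : (p : ℤ) ∣ lam - (lam - c) := Int.dvd_sub h hdvd
      exact hc (by simpa using h')
    obtain ⟨r, hr⟩ := hdvd
    have hlamU : IsUnit ((lam : ℤ) : EisensteinCoeff p (p ^ s + d + 1) k) := isUnit_intCast_of_not_dvd p _ k hlam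
    have hpA : ((lam - c : ℤ) : EisensteinCoeff p (p ^ s + d + 1) k) = -(T ^ (p ^ s + d + 1) * (r : EisensteinCoeff p _ k)) := by
      rw [hr, Int.cast_mul, Int.cast_natCast, natCast_eq_neg_mk_X_pow p (p ^ s + d + 1) k, ← hT]
      ring
    -- the unit cofactor `w = λ(1 + T c') − T^{d+1} r = λ + T (λ c' − T^d r)`
    have hw : IsUnit ((lam : EisensteinCoeff p (p ^ s + d + 1) k) +
        T * ((lam : EisensteinCoeff p (p ^ s + d + 1) k) * c' - T ^ d * (r : EisensteinCoeff p _ k))) :=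
      isUnit_add_mk_X_mul p hlamU _
    obtain ⟨w, hw'⟩ := hw
    refine ⟨((w⁻¹ : (EisensteinCoeff p (p ^ s + d + 1) k)ˣ) : EisensteinCoeff p _ k), ?_⟩
    have hfac : (lam : EisensteinCoeff p (p ^ s + d + 1) k) * onePlusT p (p ^ s + d + 1) k ^ (p ^ s) -
        (c : EisensteinCoeff p (p ^ s + d + 1) k) = T ^ (p ^ s) * (w : EisensteinCoeff p _ k) := by
      rw [hx, hpA, hw']
      ring
    rw [hfac, mul_assoc, Units.mul_inv, mul_one]
  · -- `p ∤ λ − c`: `λu − c = (λ − c) + T · (λ T^{p^s - 1}(1 + T c'))` is a unit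
    have hU : IsUnit (((lam - c : ℤ) : EisensteinCoeff p (p ^ s + d + 1) k) +
        T * ((lam : EisensteinCoeff p (p ^ s + d + 1) k) * T ^ (p ^ s - 1) * (1 + T * c'))) :=
      isUnit_add_mk_X_mul p (isUnit_intCast_of_not_dvd p _ k hdvd) _
    obtain ⟨w, hw'⟩ := hU
    refine ⟨((w⁻¹ : (EisensteinCoeff p (p ^ s + d + 1) k)ˣ) : EisensteinCoeff p _ k) * T ^ (p ^ s), ?_⟩
    have hfac : (lam : EisensteinCoeff p (p ^ s + d + 1) k) * onePlusT p (p ^ s + d + 1) k ^ (p ^ s) -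
        (c : EisensteinCoeff p (p ^ s + d + 1) k) = (w : EisensteinCoeff p _ k) := by
      rw [hx, hw']
      have hpow : T ^ (p ^ s) = T * T ^ (p ^ s - 1) := by
        rw [← pow_succ', Nat.sub_add_cancel hps]
      rw [hpow]
      ring
    rw [hfac, ← mul_assoc, Units.mul_inv, one_mul]

end Literature.NumberTheory.EllipticCurves.IwasawaAlgebra.EisensteinCoeff
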